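import Mathlib
import HarnessLib
import Summits.Ventures.LatticeQCDFlow.Exactness.FlowPushforward
import Summits.Ventures.LatticeQCDFlow.Exactness.KickAngleJacobian
import Summits.Ventures.LatticeQCDFlow.Exactness.SphereGeodesicKick
import Summits.Ventures.LatticeQCDFlow.Exactness.SphereAxisCoordinates
import Summits.Ventures.LatticeQCDFlow.Exactness.SphereKickJacobian

/-!
# Engel–Schaefer eq. (18) for an arbitrary local field on the site sphere of any `(n+2)`-dimensional real inner product space, against any additive Haar surface measure

HONEST FRAMING: exact (Metropolis-corrected) sampling algorithms for lattice gauge theory;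
figures of merit are autocorrelation/cost numbers at stated couplings and volumes; no
continuum-physics claim.

Venture `LatticeQCDFlow` (cell pub-lqcd), topic `Exactness`; FANOUT row 7 (`s0-cpn-null`: the
S0-D1 rung — 2D CP⁹, Lüscher's LO trivializing map inside HMC, Engel–Schaefer 2011).  NEW WORK of
the cell over Mathlib (`Measure.toSphere`, uniqueness of additive Haar measure
`Measure.isAddLeftInvariant_eq_smul`, `stdOrthonormalBasis`, `reflection_sub`,
`LinearIsometry.angle_map`) and the tree's `Exactness/SphereKickJacobian.lean`
(`hasJacobian_sphereKick_polarAxis`, `HasJacobian.of_semiconj`, `sphereKick`),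
`Exactness/SphereGeodesicKick.lean` (`geodesicKick_map`: covariance of the site update under
linear isometries), `Exactness/SphereAxisCoordinates.lean` (`polarAxis`); nothing is cited as a
fact.  Printed counterparts, NAMED ONLY: Engel–Schaefer, Comput. Phys. Commun. 182 (2011) 2107,
§3 eqs. (17)–(18) (site variable `x ∈ S^{2N−1} ⊂ ℂ^N ≅ ℝ^{2N}`, local field `J` in any direction).

`SphereKickJacobian.lean` proves eq. (18) for the field ALONG THE AXIS of the model space
`ℝ^{n+2}` and Mathlib's `volume.toSphere`.  Here the statement is moved to its natural
generality by a linear isometry that takes `Ĵ = J/‖J‖` to the axis (an orthonormal basis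
followed by the reflection swapping `Ĵ` and `e₀`) and by uniqueness of Haar measure: ANY
finite-dimensional real inner product space `V` with `dim V = n + 2`, ANY additive Haar measure
`μ` on `V` (its cone measure `μ.toSphere` on the unit sphere), ANY local field `J ≠ 0` with
`|c| ‖J‖ ≤ 1`.

## Content

* `HasJacobian.smul` — Jacobians are insensitive to scaling the reference measure.
* `isoSphere T : S(V) ≃ᵐ S(W)` — a linear isometric equivalence restricted to unit spheres;
  `toSphere_smul`, **`map_isoSphere_toSphere`** — the cone measure is transported:
  `(isoSphere T)_* μ.toSphere = (T_* μ).toSphere`.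
* `exists_linearIsometryEquiv_apply_eq_polarAxis` — for `dim V = n + 2` and a unit vector `e`
  there is `T : V ≃ₗᵢ ℝ^{n+2}` with `T e = e₀`; `exists_isoSphere_map_toSphere` — and it carries
  `μ.toSphere` to a multiple of `volume.toSphere` (uniqueness of Haar measure).
* **`hasJacobian_sphereKick`** — E–S eq. (18) in general position: for `J ≠ 0`, `|c| ‖J‖ ≤ 1`,
  `HasJacobian μ.toSphere (sphereKick c J) (x ↦ kickJac (c‖J‖) n (angle J x))`;
  `hasJacobian_sphereKick'` — the same for every `J` with `|c| ‖J‖ ≤ 1` (`J = 0`: identity map,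
  factor `1`); `lintegral_toSphere_comp_sphereKick'` (the integral identity) and
  `map_sphereKick_withDensity'` (the model-density / exactness form);
  `exists_map_angle_toSphere_eq_smul_polarLaw` — the polar angle from any axis is distributed
  `∝ sin^n θ dθ` under any Haar cone measure.

NOT CLAIMED: the update as a measurable equivalence of the sphere (bijectivity), the product over
sites / the checkerboard sweep (`CheckerboardSweep.lean` composes per-site Jacobians), the U(1)
link variables of the CP(N−1) action, anything about autocorrelations.
-/

noncomputable section

namespace Summit.Ventures.LatticeQCDFlow.Exactness

open Real Set MeasureTheory Measure InnerProductGeometry Metric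
open scoped ENNReal InnerProductSpace NNReal Pointwise

/-! ## §1 Scaling the reference measure -/

section Smul

variable {Ω : Type*} [MeasurableSpace Ω]

/-- Jacobians are insensitive to scaling the reference measure: `F_* (J · a vol) = a vol`. -/
theorem HasJacobian.smul {vol : Measure Ω} {F : Ω → Ω} {J : Ω → ℝ≥0∞} (h : HasJacobian vol F J)
    (a : ℝ≥0∞) : HasJacobian (a • vol) F J where
  measurable := h.measurable
  measurable_jac := h.measurable_jac
  map_eq := by rw [withDensity_smul_measure, Measure.map_smul, h.map_eq]

end Smul

/-! ## §2 Linear isometries act on unit spheres and transport the cone measure -/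

section Iso

variable {V W : Type*} [NormedAddCommGroup V] [InnerProductSpace ℝ V] [MeasurableSpace V]
  [BorelSpace V] [NormedAddCommGroup W] [InnerProductSpace ℝ W] [MeasurableSpace W] [BorelSpace W]

/-- A linear isometric equivalence restricted to the unit spheres, as a measurable equivalence. -/
def isoSphere (T : V ≃ₗᵢ[ℝ] W) : sphere (0 : V) 1 ≃ᵐ sphere (0 : W) 1 where
  toFun x := ⟨T x, mem_sphere_zero_iff_norm.2 ((T.norm_map x).trans (norm_eq_of_mem_sphere x))⟩
  invFun y := ⟨T.symm y,
    mem_sphere_zero_iff_norm.2 ((T.symm.norm_map y).trans (norm_eq_of_mem_sphere y))⟩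
  left_inv x := Subtype.ext (T.symm_apply_apply (x : V))
  right_inv y := Subtype.ext (T.apply_symm_apply (y : W))
  measurable_toFun := ((T.continuous.comp continuous_subtype_val).subtype_mk _).measurable
  measurable_invFun := ((T.symm.continuous.comp continuous_subtype_val).subtype_mk _).measurable

/-- `isoSphere T` in vector form. -/
@[simp] theorem coe_isoSphere (T : V ≃ₗᵢ[ℝ] W) (x : sphere (0 : V) 1) :
    (isoSphere T x : W) = T x := rfl

/-- The inverse of `isoSphere T` in vector form. -/
@[simp] theorem coe_isoSphere_symm (T : V ≃ₗᵢ[ℝ] W) (y : sphere (0 : W) 1) :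
    ((isoSphere T).symm y : V) = T.symm y := rfl

/-- **Covariance of the site update on spheres**: a linear isometric equivalence intertwines the
updates for the field `J` and for its image `T J` (`SphereGeodesicKick.geodesicKick_map`). -/
theorem isoSphere_sphereKick (T : V ≃ₗᵢ[ℝ] W) (c : ℝ) (J : V) (x : sphere (0 : V) 1) :
    isoSphere T (sphereKick c J x) = sphereKick c (T J) (isoSphere T x) :=
  Subtype.ext (geodesicKick_map T.toLinearIsometry c J (x : V)).symm

/-- The same read backwards through `T⁻¹`: `sphereKick c J ∘ T⁻¹ = T⁻¹ ∘ sphereKick c (T J)`. -/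
theorem sphereKick_isoSphere_symm (T : V ≃ₗᵢ[ℝ] W) (c : ℝ) (J : V) (y : sphere (0 : W) 1) :
    sphereKick c J ((isoSphere T).symm y) = (isoSphere T).symm (sphereKick c (T J) y) := by
  apply (isoSphere T).injective
  rw [isoSphere_sphereKick, MeasurableEquiv.apply_symm_apply, MeasurableEquiv.apply_symm_apply]

/-- The cone measure scales with the ambient measure: `(a • μ).toSphere = a • μ.toSphere`. -/
theorem toSphere_smul (a : ℝ≥0∞) (μ : Measure V) : (a • μ).toSphere = a • μ.toSphere := by
  ext s hs
  simp only [Measure.smul_apply, smul_eq_mul]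
  rw [toSphere_apply' _ hs, toSphere_apply' _ hs, Measure.smul_apply, smul_eq_mul, mul_left_comm]

/-- The cones over a set of the sphere and over its isometric image correspond under the isometry. -/
theorem preimage_smul_image_isoSphere (T : V ≃ₗᵢ[ℝ] W) (s : Set (sphere (0 : W) 1)) :
    T ⁻¹' (Ioo (0 : ℝ) 1 • ((↑) '' s : Set W)) =
      Ioo (0 : ℝ) 1 • ((↑) '' (isoSphere T ⁻¹' s) : Set V) := by
  ext x
  constructor
  · intro hx
    obtain ⟨t, ht, y, ⟨z, hz, rfl⟩, h⟩ := Set.mem_smul.1 hx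
    refine Set.mem_smul.2 ⟨t, ht, T.symm z, ⟨(isoSphere T).symm z, ?_, rfl⟩, ?_⟩
    · show isoSphere T ((isoSphere T).symm z) ∈ s
      rwa [MeasurableEquiv.apply_symm_apply]
    · apply T.injective
      rw [map_smul, LinearIsometryEquiv.apply_symm_apply, h]
  · intro hx
    obtain ⟨t, ht, y, ⟨z, hz, rfl⟩, rfl⟩ := Set.mem_smul.1 hx
    exact Set.mem_smul.2 ⟨t, ht, T z, ⟨isoSphere T z, hz, rfl⟩, by rw [map_smul]⟩

/-- **Linear isometries transport the cone measure**: `(isoSphere T)_* μ.toSphere = (T_* μ).toSphere`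
(Mathlib's `toSphere_apply'`: `μ.toSphere s = dim · μ(cone over s)`; the isometry maps cones to
cones and preserves the dimension). -/
theorem map_isoSphere_toSphere (T : V ≃ₗᵢ[ℝ] W) (μ : Measure V) :
    (μ.toSphere).map (isoSphere T) = (μ.map T).toSphere := by
  ext s hs
  rw [MeasurableEquiv.map_apply, toSphere_apply' _ ((isoSphere T).measurable hs), toSphere_apply' _ hs,
    ← LinearIsometryEquiv.coe_toMeasurableEquiv, MeasurableEquiv.map_apply,
    LinearIsometryEquiv.coe_toMeasurableEquiv, preimage_smul_image_isoSphere,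
    T.toLinearEquiv.finrank_eq]

end Iso

/-! ## §3 An isometry to the model space taking a unit vector to the axis -/

section Model

variable {V : Type*} [NormedAddCommGroup V] [InnerProductSpace ℝ V] [FiniteDimensional ℝ V]

/-- For `dim V = n + 2` and a unit vector `e ∈ V` there is a linear isometric equivalence
`T : V ≃ₗᵢ ℝ^{n+2}` with `T e = e₀` (an orthonormal basis, then the reflection swapping the image of
`e` with the axis). -/
theorem exists_linearIsometryEquiv_apply_eq_polarAxis (n : ℕ) (hV : Module.finrank ℝ V = n + 2)
    {e : V} (he : ‖e‖ = 1) :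
    ∃ T : V ≃ₗᵢ[ℝ] EuclideanSpace ℝ (Fin (n + 2)), T e = polarAxis n := by
  let T₀ : V ≃ₗᵢ[ℝ] EuclideanSpace ℝ (Fin (n + 2)) :=
    ((stdOrthonormalBasis ℝ V).reindex (finCongr hV)).repr
  have hu : ‖T₀ e‖ = ‖polarAxis n‖ := by rw [LinearIsometryEquiv.norm_map, he, norm_polarAxis]
  exact ⟨T₀.trans (Submodule.reflection (ℝ ∙ (T₀ e - polarAxis n))ᗮ), by
    rw [LinearIsometryEquiv.trans_apply, Submodule.reflection_sub hu]⟩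

end Model

/-! ## §4 E–S eq. (18) in general position -/

section General

variable (n : ℕ) {V : Type*} [NormedAddCommGroup V] [InnerProductSpace ℝ V] [FiniteDimensional ℝ V]
  [MeasurableSpace V] [BorelSpace V]

omit [FiniteDimensional ℝ V] in
/-- The polar angle from `J` is a measurable function on the sphere (`arccos` of a continuous
function). -/
theorem measurable_angle_coe (J : V) : Measurable fun x : sphere (0 : V) 1 => angle J (x : V) := by
  have h1 : Continuous fun x : sphere (0 : V) 1 => ⟪J, (x : V)⟫_ℝ :=
    continuous_const.inner continuous_subtype_val
  have h2 : Continuous fun x : sphere (0 : V) 1 => ‖J‖ * ‖(x : V)‖ :=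
    continuous_const.mul (continuous_norm.comp continuous_subtype_val)
  exact Real.continuous_arccos.measurable.comp (h1.measurable.div h2.measurable)

omit [FiniteDimensional ℝ V] in
/-- The printed Jacobian read through the polar angle from the field `J` is measurable on the
sphere. -/
theorem measurable_ofReal_kickJac_angle (κ : ℝ) (m : ℕ) (J : V) :
    Measurable fun x : sphere (0 : V) 1 => ENNReal.ofReal (kickJac κ m (angle J (x : V))) :=
  ENNReal.measurable_ofReal.comp ((measurable_kickJac κ m).comp (measurable_angle_coe J))

/-- **Reduction to the model.**  For `dim V = n + 2`, an additive Haar measure `μ` on `V` and a unit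
vector `e`, there is a linear isometric equivalence `T : V ≃ₗᵢ ℝ^{n+2}` with `T e = e₀` under which
the cone measure `μ.toSphere` is carried to a MULTIPLE of the model surface measure
`volume.toSphere` (uniqueness of Haar measure: `T_* μ = a • volume`). -/
theorem exists_isoSphere_map_toSphere (hV : Module.finrank ℝ V = n + 2) (μ : Measure V)
    [μ.IsAddHaarMeasure] {e : V} (he : ‖e‖ = 1) :
    ∃ (T : V ≃ₗᵢ[ℝ] EuclideanSpace ℝ (Fin (n + 2))) (a : ℝ≥0∞), T e = polarAxis n ∧
      (μ.toSphere).map (isoSphere T) =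
        a • (volume : Measure (EuclideanSpace ℝ (Fin (n + 2)))).toSphere := by
  obtain ⟨T, hT⟩ := exists_linearIsometryEquiv_apply_eq_polarAxis n hV he
  haveI : (μ.map T).IsAddHaarMeasure := by
    have h := T.toContinuousLinearEquiv.isAddHaarMeasure_map μ
    rwa [LinearIsometryEquiv.coe_toContinuousLinearEquiv] at h
  set a : ℝ≥0 := (μ.map T).addHaarScalarFactor volume with ha
  have hν : μ.map T = (a : ℝ≥0∞) • (volume : Measure (EuclideanSpace ℝ (Fin (n + 2)))) := by
    have h := Measure.isAddLeftInvariant_eq_smul (μ.map T)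
      (volume : Measure (EuclideanSpace ℝ (Fin (n + 2))))
    rw [h, ← ha]
    ext s hs
    rw [Measure.coe_nnreal_smul_apply, Measure.smul_apply, smul_eq_mul]
  exact ⟨T, a, hT, by rw [map_isoSphere_toSphere, hν, toSphere_smul]⟩

/-- **Engel–Schaefer eq. (18), general position.**  Let `V` be a real inner product space of
dimension `n + 2` (for CP(N−1): `V = ℂ^N ≅ ℝ^{2N}`, `n = 2N − 2`), `μ` an additive Haar measure on
`V` and `μ.toSphere` its cone (surface) measure on the unit sphere, `J ≠ 0` the local field and
`c` a step constant with `|c| ‖J‖ ≤ 1`.  Then the single-site leading-order update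
`sphereKick c J : x ↦ cos(c‖p‖) x + (sin(c‖p‖)/‖p‖) p`, `p = J − ⟪J, x⟫ x`, has the exact Jacobian
`x ↦ kickJac (c‖J‖) n (angle J x) = (1 − κ cos θ')(sin θ / sin θ')^n` (`κ = c‖J‖`,
`θ' = angle J x`, `θ = θ' − κ sin θ'`) with respect to `μ.toSphere`:
`(sphereKick c J)_* (kickJac · μ.toSphere) = μ.toSphere`. -/
theorem hasJacobian_sphereKick (hV : Module.finrank ℝ V = n + 2) (μ : Measure V) [μ.IsAddHaarMeasure]
    {c : ℝ} {J : V} (hJ : J ≠ 0) (hc : |c| * ‖J‖ ≤ 1) :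
    HasJacobian μ.toSphere (sphereKick c J)
      fun x => ENNReal.ofReal (kickJac (c * ‖J‖) n (angle J (x : V))) := by
  have hr : 0 < ‖J‖ := norm_pos_iff.2 hJ
  have hκ : |c * ‖J‖| ≤ 1 := by rwa [abs_mul, abs_norm]
  -- an isometry to the model space taking `Ĵ` to the axis, the cone measure to `a • volume.toSphere`
  obtain ⟨T, a, hT, hσ⟩ := exists_isoSphere_map_toSphere n hV μ (e := ‖J‖⁻¹ • J)
    (by rw [norm_smul, norm_inv, norm_norm, inv_mul_cancel₀ hr.ne'])
  have hTJ : T J = ‖J‖ • polarAxis n := by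
    rw [← hT, map_smul, smul_smul, mul_inv_cancel₀ hr.ne', one_smul]
  have hTsymm : T.symm (‖J‖ • polarAxis n) = J := by rw [← hTJ, T.symm_apply_apply]
  -- the model statement, scaled, then transported back along `(isoSphere T)⁻¹`
  have h₀ := (hasJacobian_sphereKick_polarAxis n hr hκ).smul a
  rw [← hσ] at h₀
  have hconj : ∀ y : sphere (0 : EuclideanSpace ℝ (Fin (n + 2))) 1,
      sphereKick c J ((isoSphere T).symm y) =
        (isoSphere T).symm (sphereKick c (‖J‖ • polarAxis n) y) := by
    intro y
    rw [sphereKick_isoSphere_symm, hTJ]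
  have hjac : ∀ y : sphere (0 : EuclideanSpace ℝ (Fin (n + 2))) 1,
      ENNReal.ofReal (kickJac (c * ‖J‖) n (angle J (((isoSphere T).symm y : sphere (0 : V) 1) : V))) =
        ENNReal.ofReal (kickJac (c * ‖J‖) n
          (angle (polarAxis n) (y : EuclideanSpace ℝ (Fin (n + 2))))) := by
    intro y
    have hang : angle J (T.symm (y : EuclideanSpace ℝ (Fin (n + 2)))) =
        angle (polarAxis n) (y : EuclideanSpace ℝ (Fin (n + 2))) := by
      have h2 := T.symm.toLinearIsometry.angle_map (‖J‖ • polarAxis n)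
        (y : EuclideanSpace ℝ (Fin (n + 2)))
      rwa [LinearIsometryEquiv.coe_toLinearIsometry, hTsymm, angle_smul_polarAxis n hr] at h2
    rw [coe_isoSphere_symm, hang]
  have h₁ := HasJacobian.of_semiconj (isoSphere T).symm.measurable h₀ (measurable_sphereKick c J)
    (measurable_ofReal_kickJac_angle (c * ‖J‖) n J) (Filter.Eventually.of_forall hconj)
    (Filter.Eventually.of_forall hjac)
  rwa [MeasurableEquiv.map_symm_map] at h₁

omit [FiniteDimensional ℝ V] [MeasurableSpace V] [BorelSpace V] in
/-- With a vanishing local field the update is the identity … -/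
theorem sphereKick_zero (c : ℝ) (x : sphere (0 : V) 1) : sphereKick c (0 : V) x = x :=
  Subtype.ext (by simp [coe_sphereKick, geodesicKick, tangentKick])

omit [FiniteDimensional ℝ V] [MeasurableSpace V] [BorelSpace V] in
/-- … and the printed factor, read at `J = 0` (`angle 0 x = π/2`, `κ = 0`), is `1`. -/
theorem kickJac_angle_zero (c : ℝ) (x : V) : kickJac (c * ‖(0 : V)‖) n (angle 0 x) = 1 := by
  rw [norm_zero, mul_zero, angle_zero_left, kickJac, kickAngle_zero_left, cos_pi_div_two,
    sin_pi_div_two, mul_zero, sub_zero, div_one, one_pow, mul_one]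

/-- **E–S eq. (18) for every local field with `|c| ‖J‖ ≤ 1`**, the case `J = 0` (identity map,
factor `1`) included — the form consumed site by site by the sweep
(`CheckerboardSweep.hasJacobian_sweep`, hypothesis `hJ`). -/
theorem hasJacobian_sphereKick' (hV : Module.finrank ℝ V = n + 2) (μ : Measure V)
    [μ.IsAddHaarMeasure] {c : ℝ} {J : V} (hc : |c| * ‖J‖ ≤ 1) :
    HasJacobian μ.toSphere (sphereKick c J)
      fun x => ENNReal.ofReal (kickJac (c * ‖J‖) n (angle J (x : V))) := by
  rcases eq_or_ne J 0 with rfl | hJ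
  · have h1 : sphereKick c (0 : V) = id := funext (sphereKick_zero c)
    have h2 : (fun x : sphere (0 : V) 1 =>
        ENNReal.ofReal (kickJac (c * ‖(0 : V)‖) n (angle 0 (x : V)))) = fun _ => 1 := by
      funext x
      rw [kickJac_angle_zero, ENNReal.ofReal_one]
    rw [h1, h2]
    exact hasJacobian_id _
  · exact hasJacobian_sphereKick n hV μ hJ hc

/-- **E–S eq. (18) as an integral identity, general position**: for measurable `q ≥ 0` on the
unit sphere of `V`, `∫ q dμ.toSphere = ∫ q(sphereKick c J x) · kickJac (c‖J‖) n (angle J x) dμ.toSphere`. -/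
theorem lintegral_toSphere_comp_sphereKick' (hV : Module.finrank ℝ V = n + 2) (μ : Measure V)
    [μ.IsAddHaarMeasure] {c : ℝ} {J : V} (hJ : J ≠ 0) (hc : |c| * ‖J‖ ≤ 1)
    {q : sphere (0 : V) 1 → ℝ≥0∞} (hq : Measurable q) :
    ∫⁻ x, q x ∂μ.toSphere =
      ∫⁻ x, q (sphereKick c J x) * ENNReal.ofReal (kickJac (c * ‖J‖) n (angle J (x : V)))
        ∂μ.toSphere :=
  (hasJacobian_sphereKick n hV μ hJ hc).lintegral_comp_mul hq

/-- **Exactness form, general position**: for every measurable weight `p ≥ 0` on the unit sphere,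
the update pushes `(p ∘ sphereKick c J) · kickJac` forward to `p`:
`(sphereKick c J)_* (((p ∘ sphereKick c J) · kickJac (c‖J‖) n (angle J ·)) · μ.toSphere) = p · μ.toSphere`
— the hypothesis of `TransformedKernel.transformedUpdate_invariant` for the CP(N−1) site update,
read at the level of measures. -/
theorem map_sphereKick_withDensity' (hV : Module.finrank ℝ V = n + 2) (μ : Measure V)
    [μ.IsAddHaarMeasure] {c : ℝ} {J : V} (hJ : J ≠ 0) (hc : |c| * ‖J‖ ≤ 1)
    {p : sphere (0 : V) 1 → ℝ≥0∞} (hp : Measurable p) :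
    (μ.toSphere.withDensity fun x =>
        p (sphereKick c J x) * ENNReal.ofReal (kickJac (c * ‖J‖) n (angle J (x : V)))).map
        (sphereKick c J) =
      μ.toSphere.withDensity p :=
  (hasJacobian_sphereKick n hV μ hJ hc).map_withDensity hp

/-- **The law of the polar angle, general position.**  Under the cone (surface) measure of the
unit sphere of an `(n+2)`-dimensional real inner product space, the polar angle `angle J x` from
ANY axis `J ≠ 0` is distributed proportionally to `sin^n θ dθ` on `[0, π]`
(`SphereAxisDisintegration.map_angle_polarAxis_toSphere` transported): the marginal on which the
E–S site update acts (CP(N−1): `sin^{2N−2} θ dθ`). -/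
theorem exists_map_angle_toSphere_eq_smul_polarLaw (hV : Module.finrank ℝ V = n + 2) (μ : Measure V)
    [μ.IsAddHaarMeasure] {J : V} (hJ : J ≠ 0) :
    ∃ C : ℝ≥0∞, (μ.toSphere).map (fun x : sphere (0 : V) 1 => angle J (x : V)) = C • polarLaw n := by
  have hr : 0 < ‖J‖ := norm_pos_iff.2 hJ
  obtain ⟨T, a, hT, hσ⟩ := exists_isoSphere_map_toSphere n hV μ (e := ‖J‖⁻¹ • J)
    (by rw [norm_smul, norm_inv, norm_norm, inv_mul_cancel₀ hr.ne'])
  have hTJ : T J = ‖J‖ • polarAxis n := by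
    rw [← hT, map_smul, smul_smul, mul_inv_cancel₀ hr.ne', one_smul]
  have hTsymm : T.symm (‖J‖ • polarAxis n) = J := by rw [← hTJ, T.symm_apply_apply]
  refine ⟨a * (volume : Measure (EuclideanSpace ℝ (Fin (n + 1)))).toSphere univ, ?_⟩
  have hfun : ((fun x : sphere (0 : V) 1 => angle J (x : V)) ∘ (isoSphere T).symm) =
      fun y : sphere (0 : EuclideanSpace ℝ (Fin (n + 2))) 1 =>
        angle (polarAxis n) (y : EuclideanSpace ℝ (Fin (n + 2))) := by
    funext y
    have h2 := T.symm.toLinearIsometry.angle_map (‖J‖ • polarAxis n)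
      (y : EuclideanSpace ℝ (Fin (n + 2)))
    rw [LinearIsometryEquiv.coe_toLinearIsometry, hTsymm, angle_smul_polarAxis n hr] at h2
    rw [Function.comp_apply, coe_isoSphere_symm, h2]
  rw [← MeasurableEquiv.map_symm_map (isoSphere T) (μ := μ.toSphere), hσ,
    Measure.map_map (measurable_angle_coe J) (isoSphere T).symm.measurable, hfun, Measure.map_smul,
    map_angle_polarAxis_toSphere, smul_smul]

end General

end Summit.Ventures.LatticeQCDFlow.Exactness

end
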